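/-
Copyright (c) 2026 the pub-hodgecm-mathlib formalisation cell (harness21).  Prover seat hodgecm-mathlib-K2E3-p14 (g8), Track B «K2-LIT» ∕ h413
(`stmt-HodgeConjecture-24833`), line `K2_E3_EllipticInputs`, PART «RANK» (qs2-ps) «van Dijk₂» (cut K2E3-p21 (g7)), brick D118 (WEYL₂), stage W2-3 «DENSITY₂»:
THE WEYL INTEGRATION FORMULA ON THE HYPERBOLIC SET OF `U(1,1) = U(Φ₂)(L⁺_v)` IN DENSITY FORM `|D_G|² dt` — UNCONDITIONAL — the `N = 2` port of ★ `K2E3WeylHypDensityMeasurable`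
(and of the (TOR) road's ★ `…WeylHypJacobianLocal` ∕ `…WIFJacLocal` ∕ `…WIFDensity`), obtained from the GENERIC weighted Weyl formula ★ `F0P3cStCharTSUpTrJacobian` §1∕§2 and the
★ JAC-LOC₂ terminus `F0P3cStCharTSUpTrJacSplitModelTwo.tubeJacobianLocal_splitCartan_U2`.  2026-09-04.
-/
import Summits.HodgeConjecture.HodgeConjecture.Theorems.K2E3QuasiSplitTwoWeylKit            -- (this seat, W2-2 p860822) KIT₂: `hyperbolicSet₂_eq_hypSet`, `isCompact_isOpen_compactCore_cmTorus₂`, `ae_isRegularElt_cmTorus₂`, `isHaarMeasure_map_torusChart₂`, `classOrbitalIntegral_mk_eq_integral_conjFamily₂`; brings ★ W2-1, ★ D115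
import Summits.HodgeConjecture.HodgeConjecture.Theorems.F0P3cStCharTSUpTrJacobian            -- ★ (H3e) (F0P3a-p02 (g24)) GENERIC §1 `lintegral_cartanSet_eq_of_tubeJacobian_local`, §2 `integral_cartanSet_eq_of_tubeJacobian_local`
import Summits.HodgeConjecture.HodgeConjecture.Theorems.F0P3cStCharTSUpTrJacSplitModelTwo    -- ★ (B8-D) (LH6-p04 (g7)) JAC-LOC₂ TERMINUS `tubeJacobianLocal_splitCartan_U2` (the local tube Jacobian at `T₂`, weight `√(N(disc)·N(det)⁻¹)`, unconditional)
import Summits.HodgeConjecture.HodgeConjecture.Theorems.F0P3cStCharTSDGFieldTwo               -- ★ (F0P3-p02) `continuous_dgFormulaTwo` (the `N = 2` Weyl discriminant is continuous)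
import Literature.NumberTheory.Rogawski1990.LocalEndoscopicChartDatumCM                         -- ★ `isOpen_setOf_isRegularElt_cmDatum_local` (the regular locus of `U(Φ₂)(L⁺_v)` is open, non-split `v`)
import HarnessLib

/-!
# K2_E3 road (h413), PART «RANK» (qs2-ps), brick (WEYL₂) W2-3 «DENSITY₂» — the Weyl integration formula on the hyperbolic set of `U(1,1)`, DENSITY FORM (unconditional)

Cell `pub/hodgecm-mathlib` (D-0151), Track B, seat K2E3-p14 (g8); dealer K2E3-plan (g4) D118; consumer (ASM₂) = K2E3-p21 (g8) (`hWEYL`).  `--supports stmt-HodgeConjecture-24833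
--as helper`; THEOREMS ONLY (no `def`, no instance, no notation, no named fact, no `sorry`); ★-only imports; never imports `Cruxes/…/Lines`.  COUNT-NEUTRAL.

THE MATHEMATICS [Rogawski1990, §12.5 p. 182; HarishChandra1970, Lemmas 22, 42; vanDijk1972, §2].  `v` NON-SPLIT, `G₂ = U(Φ₂)(L⁺_v)`, `T₂ = (cmBorelTriple L 2 v).M ≅ E_wˣ` its
diagonal torus (chart `ι₂`, ★ D115), `Ω₂` the hyperbolic set, `|W(T₂)| = 2`.  For every Haar `ν` on `G₂` and Haar `tm` on `T₂`, `μ₀ = ν∕tm` on `G₂ ⧸ T₂`, and every Borel `f ≥ 0`: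
**`2 · ∫_{Ω₂} f dν = ∫_{T₂^{reg}} D(t) · ∫_{G₂⧸T₂} f(x t x⁻¹) dμ₀(ẋ) dtm(t)`,  `D(t) = |D_G(t)|² = √( N(discr χ_t) · N(det t)⁻¹ ) = dgFormula₂(t)²`** (`N(x) = Π_{w∣v} |x_w|_w`) — the
GENERIC weighted Weyl formula ★ `F0P3cStCharTSUpTrJacobian` (fibre-count pull-back, Weil factorisation, local-to-global patching of the radial measure) at `(G₂, G₂^{reg}, T₂)`, whose
one input «local tube Jacobian at `T₂`» is the ★ JAC-LOC₂ terminus `tubeJacobianLocal_splitCartan_U2` (Harish-Chandra's Lemma 22 for `U(1,1)`, roads (B1)–(B8) of Track A).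
* §1 `dgFormula₂_sq_eq_coe_sqrt` (`dg₂² = √(N(disc)·N(det)⁻¹)`), `continuous_dgFormula₂`, `measurable_sqrt_radicand₂`, `isOpen_setOf_isRegularElt₂`; **`tubeJacobianLocal_cmTorus₂`** — the ★
  JAC-LOC₂ terminus re-read on the road's carrier `G₂ = ↥(unitaryGroupOfForm (conjLocal L c v) (cmLocalForm L 2 v))` at `T₂` (definitional transport of the σ-algebra ∕ Haar instances).
* §2 **`lintegral_hypSet₂_eq_of_haar`** (the `∫⁻` form above, every Haar `tm`), **`integral_hypSet₂_eq_of_haar`** (Bochner form + Fubini integrability for `g ∈ L¹(Ω₂, ν)`).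
* §3 THE (ASM₂) HEADS — `N = 2` twins of ★ `K2E3WeylHypDensityMeasurable`: for `mQv` CANONICAL, `μM` Haar on the parameter torus `(LocalRing L v)ˣ`, `c₀ = μM(ι₂⁻¹ T₂ᶜ)`, all `φ, α : G₂ → ℂ`
  with `φ` measurable, `α` conjugation invariant on `Ω₂ = hyperbolicSet₂ L v`, `φ·α ∈ L¹(Ω₂, ν)`, `φ = 0` off `Ω₂`:
  **`integral_mul_eq_integral_classOrbitalIntegral_density₂`**: `∫ φ·α dν = ∫ m, O^{can}(φ)⟦ι₂ m⟧ · ((2 c₀)⁻¹ · dgFormula₂(ι₂ m)²) · α(ι₂ m) dμM`;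
  **`integrable_classOrbitalIntegral_density_mul₂`**: that integrand is `μM`-integrable; **`density_wif_and_integrable₂`**: both at once.
HONEST LABEL: HC_CM is proved only modulo the 7 printed citations (2 remaining named inputs: hLiu418 = stmt-HodgeConjecture-24832, h413 = stmt-HodgeConjecture-24833)
until rung 0 closes; count-neutral helper of the (WEYL₂) line (the (qs2-ps) socket stays with its (ASM₂) payer).

## References
* [Rogawski1990] J. D. Rogawski, *Automorphic Representations of Unitary Groups in Three Variables*, Ann. of Math. Stud. 123 (1990), §12.5 pp. 182–183 (Weyl integration formula,
  `D_G`); §12.7 L. 12.7.2 (proof) p. 193; §4.3 (4.3.1) p. 43; §4.9 p. 54.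
* [HarishChandra1970] Harish-Chandra (notes by G. van Dijk), *Harmonic Analysis on Reductive p-adic Groups*, LNM 162 (1970), Part V §3 Lemma 20, §4 Lemma 22; Lemma 42.
* [vanDijk1972] G. van Dijk, *Computation of certain induced characters of p-adic groups*, Math. Ann. 199 (1972), §2.
* [DeitmarEchterhoff2014] A. Deitmar, S. Echterhoff, *Principles of Harmonic Analysis*, 2nd ed. (2014), Thm. 1.5.3 (quotient integral formula).
* [Weil1965] A. Weil, *Sur la formule de Siegel dans la théorie des groupes classiques*, Acta Math. 113 (1965), n° 49 Lemme 22.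
-/

set_option autoImplicit false
set_option linter.dupNamespace false

noncomputable section

open MeasureTheory Measure Set Filter Topology Function NumberField IsDedekindDomain Matrix Polynomial
open Literature.MeasureTheory.Group
open Literature.NumberTheory.Automorphic Literature.NumberTheory.Automorphic.UnitaryGroup Literature.NumberTheory.Rogawski1990
open Literature.NumberTheory.GaloisRepresentations Literature.NumberTheory.GaloisRepresentations.IsNonarchimedeanLocalField
open Summit.HodgeConjecture.HodgeConjecture.Cruxes.H413.F0P3cStCharTSWeylHypFibre
open Summit.HodgeConjecture.HodgeConjecture.Cruxes.H413.F0P3cStCharTSWeylHypTorsor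
open Summit.HodgeConjecture.HodgeConjecture.Cruxes.H413.F0P3cStCharTSWeylHypCM
open Summit.HodgeConjecture.HodgeConjecture.Cruxes.H413.F0P3cStCharTSWeylHypMeasure
open Summit.HodgeConjecture.HodgeConjecture.Cruxes.H413.K2E3QuasiSplitTwoWeylRadial
open Summit.HodgeConjecture.HodgeConjecture.Cruxes.H413.K2E3QuasiSplitTwoTorusDefs
open Summit.HodgeConjecture.HodgeConjecture.Cruxes.H413.K2E3QuasiSplitTwoWeylKit
open Summit.HodgeConjecture.HodgeConjecture.Cruxes.H413
open scoped ENNReal NNReal MatrixGroups Pointwise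

namespace Summit.HodgeConjecture.HodgeConjecture.Cruxes.H413.K2E3QuasiSplitTwoWeylDensity

variable (L : Type) [Field L] [NumberField L] [IsCMField L] (v : HeightOneSpectrum (𝓞 ↥(maximalRealSubfield L)))

/-! ## §1 The weight `D = dg₂² = √(N(disc)·N(det)⁻¹)`; the regular locus; the JAC-LOC₂ terminus on the road's carrier -/

/-- **`dg₂(g)² = √( N(discr χ_g) · N(det g)⁻¹ )`** as real numbers (`dg₂ = ⁴√(·)`, ★ D115 `dgFormula₂_def`; `NNReal.sq_sqrt`). [cite: Rogawski1990, §4.9 p. 54; §12.5 p. 182] -/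
theorem dgFormula₂_sq_eq_coe_sqrt (t : ↥(unitaryGroupOfForm (conjLocal L (IsCMField.complexConj L) v) (cmLocalForm L 2 v))) :
    dgFormula₂ L v t ^ 2 = ((NNReal.sqrt ((∏ w' : PlacesOver L v, normAbs (w'.1.adicCompletion L) ((((t : ↥(unitaryGroupOfForm (conjLocal L (IsCMField.complexConj L) v) (cmLocalForm L 2 v))) : GL (Fin 2) (UnitaryGroup.LocalRing L v)).val.charpoly.discr) w')) * (∏ w' : PlacesOver L v, normAbs (w'.1.adicCompletion L) ((((t : ↥(unitaryGroupOfForm (conjLocal L (IsCMField.complexConj L) v) (cmLocalForm L 2 v))) : GL (Fin 2) (UnitaryGroup.LocalRing L v)).val.det) w'))⁻¹) : ℝ≥0) : ℝ) := by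
  rw [dgFormula₂_def, ← NNReal.coe_pow, NNReal.sq_sqrt]

/-- **`dg₂` is continuous** (★ `continuous_dgFormulaTwo` at `J = Φ₂`, read on the road's carrier). [cite: Rogawski1990, §4.9 p. 54] -/
theorem continuous_dgFormula₂ : Continuous (dgFormula₂ L v) :=
  F0P3cStCharTSDGFieldTwo.continuous_dgFormulaTwo L v (Matrix.of fun i j : Fin 2 => if i.val + j.val + 1 = 2 then (1 : L) else 0)

/-- **The weight `t ↦ √(N(discr χ_t)·N(det t)⁻¹)` is Borel on `T₂`** (`= dg₂(t)²`, continuous). [cite: Rogawski1990, §4.9 p. 54] -/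
theorem measurable_sqrt_radicand₂ [MeasurableSpace ↥(unitaryGroupOfForm (conjLocal L (IsCMField.complexConj L) v) (cmLocalForm L 2 v))] [BorelSpace ↥(unitaryGroupOfForm (conjLocal L (IsCMField.complexConj L) v) (cmLocalForm L 2 v))] :
    Measurable fun t : ↥(cmBorelTriple L 2 v).M => NNReal.sqrt ((∏ w' : PlacesOver L v, normAbs (w'.1.adicCompletion L) ((((t : ↥(unitaryGroupOfForm (conjLocal L (IsCMField.complexConj L) v) (cmLocalForm L 2 v))) : GL (Fin 2) (UnitaryGroup.LocalRing L v)).val.charpoly.discr) w')) * (∏ w' : PlacesOver L v, normAbs (w'.1.adicCompletion L) ((((t : ↥(unitaryGroupOfForm (conjLocal L (IsCMField.complexConj L) v) (cmLocalForm L 2 v))) : GL (Fin 2) (UnitaryGroup.LocalRing L v)).val.det) w'))⁻¹) := by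
  have h1 : Measurable fun t : ↥(cmBorelTriple L 2 v).M => Real.toNNReal (dgFormula₂ L v (t : ↥(unitaryGroupOfForm (conjLocal L (IsCMField.complexConj L) v) (cmLocalForm L 2 v))) ^ 2) :=
    measurable_real_toNNReal.comp (((continuous_dgFormula₂ L v).comp continuous_subtype_val).measurable.pow_const 2)
  have h2 : (fun t : ↥(cmBorelTriple L 2 v).M => NNReal.sqrt ((∏ w' : PlacesOver L v, normAbs (w'.1.adicCompletion L) ((((t : ↥(unitaryGroupOfForm (conjLocal L (IsCMField.complexConj L) v) (cmLocalForm L 2 v))) : GL (Fin 2) (UnitaryGroup.LocalRing L v)).val.charpoly.discr) w')) * (∏ w' : PlacesOver L v, normAbs (w'.1.adicCompletion L) ((((t : ↥(unitaryGroupOfForm (conjLocal L (IsCMField.complexConj L) v) (cmLocalForm L 2 v))) : GL (Fin 2) (UnitaryGroup.LocalRing L v)).val.det) w'))⁻¹)) = fun t : ↥(cmBorelTriple L 2 v).M => Real.toNNReal (dgFormula₂ L v (t : ↥(unitaryGroupOfForm (conjLocal L (IsCMField.complexConj L) v) (cmLocalForm L 2 v))) ^ 2) :=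
    funext fun t => by rw [dgFormula₂_sq_eq_coe_sqrt, Real.toNNReal_coe]
  rw [h2]
  exact h1

/-- **The regular locus `G₂^{reg}` is open** (`v` non-split; ★ `isOpen_setOf_isRegularElt_cmDatum_local` read on the road's carrier). [cite: Rogawski1990, §3.1 p. 19] -/
theorem isOpen_setOf_isRegularElt₂ (hns : ∀ w : PlacesOver L v, IsCMField.complexConj L • w.1 = w.1) : IsOpen {x : ↥(unitaryGroupOfForm (conjLocal L (IsCMField.complexConj L) v) (cmLocalForm L 2 v)) | IsRegularElt (x : GL (Fin 2) (LocalRing L v))} := by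
  obtain ⟨w⟩ := (inferInstance : Nonempty (PlacesOver L v))
  exact isOpen_setOf_isRegularElt_cmDatum_local L (Matrix.of fun i j : Fin 2 => if i.val + j.val + 1 = 2 then (1 : L) else 0) w (hns w)

set_option maxHeartbeats 1600000 in
-- the long socket binders at `N = 2`; definitional transport between the two spellings of the carrier
/-- **THE LOCAL TUBE JACOBIAN AT `T₂` ON THE ROAD's CARRIER** (`v` non-split): for all Haar data `(ν, tm)`, every conjugation family `Φ(xT₂, t) = x t x⁻¹` and every regular
`t₀ ∈ T₂` there are an open `U ∋ t₀` in `T₂` and a Borel `A₀ ⊆ G₂ ⧸ T₂` with `0 < (ν∕tm)(A₀) < ∞` such that for every Borel, regular, `W`-free `V ⊆ U`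
**`ν(Φ(A₀ × V)) = (ν∕tm)(A₀) · ∫⁻_V √(N(discr χ_t)·N(det t)⁻¹) dtm`** — ★ JAC-LOC₂ TERMINUS `tubeJacobianLocal_splitCartan_U2` (LH6-p04 (g7), over (B1)–(B7b)) VERBATIM, its carrier
`(cmDatum L 2 Φ₂).Local v` being this one by `rfl` (★ `cmDatum_Local_eq`); σ-algebra and Haar instances handed over by name. [cite: HarishChandra1970, Lemma 22] [cite: vanDijk1972, §2]
[cite: Rogawski1990, §12.5 pp. 182–183] -/
theorem tubeJacobianLocal_cmTorus₂ (hns : ∀ w : PlacesOver L v, IsCMField.complexConj L • w.1 = w.1)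
    [iM : MeasurableSpace ↥(unitaryGroupOfForm (conjLocal L (IsCMField.complexConj L) v) (cmLocalForm L 2 v))] [iB : BorelSpace ↥(unitaryGroupOfForm (conjLocal L (IsCMField.complexConj L) v) (cmLocalForm L 2 v))] [LocallyCompactSpace ↥(unitaryGroupOfForm (conjLocal L (IsCMField.complexConj L) v) (cmLocalForm L 2 v))] [SecondCountableTopology ↥(unitaryGroupOfForm (conjLocal L (IsCMField.complexConj L) v) (cmLocalForm L 2 v))] [T2Space ↥(unitaryGroupOfForm (conjLocal L (IsCMField.complexConj L) v) (cmLocalForm L 2 v))]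
    [iQM : MeasurableSpace (↥(unitaryGroupOfForm (conjLocal L (IsCMField.complexConj L) v) (cmLocalForm L 2 v)) ⧸ (cmBorelTriple L 2 v).M)] [iQB : BorelSpace (↥(unitaryGroupOfForm (conjLocal L (IsCMField.complexConj L) v) (cmLocalForm L 2 v)) ⧸ (cmBorelTriple L 2 v).M)]
    (Φ : (↥(unitaryGroupOfForm (conjLocal L (IsCMField.complexConj L) v) (cmLocalForm L 2 v)) ⧸ (cmBorelTriple L 2 v).M) × ↥(cmBorelTriple L 2 v).M → ↥(unitaryGroupOfForm (conjLocal L (IsCMField.complexConj L) v) (cmLocalForm L 2 v))) (hΦ : ∀ (x : ↥(unitaryGroupOfForm (conjLocal L (IsCMField.complexConj L) v) (cmLocalForm L 2 v))) (t : ↥(cmBorelTriple L 2 v).M), Φ (QuotientGroup.mk x, t) = x * t * x⁻¹)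
    (ν : Measure ↥(unitaryGroupOfForm (conjLocal L (IsCMField.complexConj L) v) (cmLocalForm L 2 v))) [iν₁ : ν.IsHaarMeasure] [iν₂ : ν.IsMulRightInvariant]
    (tm : Measure ↥(cmBorelTriple L 2 v).M) [it₁ : tm.IsMulLeftInvariant] [it₂ : IsFiniteMeasureOnCompacts tm] [it₃ : tm.IsOpenPosMeasure] [it₄ : tm.IsInvInvariant] :
    ∀ t₀ : ↥(cmBorelTriple L 2 v).M, IsRegularElt (((t₀ : ↥(unitaryGroupOfForm (conjLocal L (IsCMField.complexConj L) v) (cmLocalForm L 2 v)))) : GL (Fin 2) (LocalRing L v)) →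
      ∃ U : Set ↥(cmBorelTriple L 2 v).M, IsOpen U ∧ t₀ ∈ U ∧
        ∃ A₀ : Set (↥(unitaryGroupOfForm (conjLocal L (IsCMField.complexConj L) v) (cmLocalForm L 2 v)) ⧸ (cmBorelTriple L 2 v).M), MeasurableSet A₀ ∧
          (quotientMeasure (cmBorelTriple L 2 v).M tm (isClosed_cmBorelTriple_M_two L v) ν) A₀ ≠ 0 ∧
          (quotientMeasure (cmBorelTriple L 2 v).M tm (isClosed_cmBorelTriple_M_two L v) ν) A₀ ≠ ∞ ∧
          ∀ V : Set ↥(cmBorelTriple L 2 v).M, MeasurableSet V → V ⊆ U → (∀ t ∈ V, IsRegularElt (((t : ↥(unitaryGroupOfForm (conjLocal L (IsCMField.complexConj L) v) (cmLocalForm L 2 v)))) : GL (Fin 2) (LocalRing L v))) →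
            (∀ n : ↥(unitaryGroupOfForm (conjLocal L (IsCMField.complexConj L) v) (cmLocalForm L 2 v)), n ∉ (cmBorelTriple L 2 v).M → ∀ t ∈ V, ∀ t' ∈ V, ((t' : ↥(cmBorelTriple L 2 v).M) : ↥(unitaryGroupOfForm (conjLocal L (IsCMField.complexConj L) v) (cmLocalForm L 2 v))) ≠ n * t * n⁻¹) →
              ν (Φ '' (A₀ ×ˢ V)) = (quotientMeasure (cmBorelTriple L 2 v).M tm (isClosed_cmBorelTriple_M_two L v) ν) A₀ *
                ∫⁻ t in V, ((NNReal.sqrt ((∏ w' : PlacesOver L v, normAbs (w'.1.adicCompletion L) ((((t : ↥(unitaryGroupOfForm (conjLocal L (IsCMField.complexConj L) v) (cmLocalForm L 2 v))) : GL (Fin 2) (UnitaryGroup.LocalRing L v)).val.charpoly.discr) w')) * (∏ w' : PlacesOver L v, normAbs (w'.1.adicCompletion L) ((((t : ↥(unitaryGroupOfForm (conjLocal L (IsCMField.complexConj L) v) (cmLocalForm L 2 v))) : GL (Fin 2) (UnitaryGroup.LocalRing L v)).val.det) w'))⁻¹) : ℝ≥0) : ℝ≥0∞) ∂tm :=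
  F0P3cStCharTSUpTrJacSplitModelTwo.tubeJacobianLocal_splitCartan_U2 L v hns (instM := iM) (instB := iB) rfl Φ hΦ (isClosed_cmBorelTriple_M_two L v)
    (instQM := iQM) (instQB := iQB) ν (instν₁ := iν₁) (instν₂ := iν₂) tm (instt₁ := it₁) (instt₂ := it₂) (instt₃ := it₃) (instt₄ := it₄)

/-! ## §2 The weighted Weyl integration formula on `Ω₂` for an arbitrary Haar measure of `T₂` -/

set_option maxHeartbeats 1600000 in
-- instance-term unification for `quotientMeasure` with its σ-algebra arguments, as in the ★ generic file
/-- **THE WEYL INTEGRATION FORMULA ON THE HYPERBOLIC SET OF `U(1,1)`, DENSITY FORM, `∫⁻` VERSION (UNCONDITIONAL).**  `v` non-split, `ν` Haar on `G₂`, `tm` ANY Haar measure on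
`T₂` (left invariant, finite on compacts, positive on opens, inversion invariant), `μ₀ = ν∕tm`, `Φ(xT₂, t) = x t x⁻¹`.  For every Borel `f ≥ 0` on `G₂`:
**`2 · ∫⁻_{Ω₂} f dν = ∫⁻_{t ∈ T₂^{reg}} √(N(discr χ_t)·N(det t)⁻¹) · ∫⁻_{G₂⧸T₂} f(Φ(q, t)) dμ₀ dtm`** — ★ GENERIC `lintegral_cartanSet_eq_of_tubeJacobian_local` at `G := G₂`,
`R := G₂^{reg}` (open §1, conjugation invariant ★ (T4)), `T := T₂` (closed ★ W2-1, abelian ★ (B4), `Z(t) = T₂` on `T₂^{reg}` ★ (A1), `[N(T₂):T₂] = 2` ★ (B4)), socket = §1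
`tubeJacobianLocal_cmTorus₂`. [cite: Rogawski1990, §12.5 p. 182] [cite: HarishChandra1970, Lemma 22; Lemma 42] [cite: Weil1965, n° 49 Lemme 22] -/
theorem lintegral_hypSet₂_eq_of_haar (hns : ∀ w : PlacesOver L v, IsCMField.complexConj L • w.1 = w.1)
    [MeasurableSpace ↥(unitaryGroupOfForm (conjLocal L (IsCMField.complexConj L) v) (cmLocalForm L 2 v))] [BorelSpace ↥(unitaryGroupOfForm (conjLocal L (IsCMField.complexConj L) v) (cmLocalForm L 2 v))] [LocallyCompactSpace ↥(unitaryGroupOfForm (conjLocal L (IsCMField.complexConj L) v) (cmLocalForm L 2 v))] [SecondCountableTopology ↥(unitaryGroupOfForm (conjLocal L (IsCMField.complexConj L) v) (cmLocalForm L 2 v))] [T2Space ↥(unitaryGroupOfForm (conjLocal L (IsCMField.complexConj L) v) (cmLocalForm L 2 v))] [MeasurableSpace (↥(unitaryGroupOfForm (conjLocal L (IsCMField.complexConj L) v) (cmLocalForm L 2 v)) ⧸ (cmBorelTriple L 2 v).M)] [BorelSpace (↥(unitaryGroupOfForm (conjLocal L (IsCMField.complexConj L) v) (cmLocalForm L 2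 v)) ⧸ (cmBorelTriple L 2 v).M)]
    (ν : Measure ↥(unitaryGroupOfForm (conjLocal L (IsCMField.complexConj L) v) (cmLocalForm L 2 v))) [ν.IsHaarMeasure] [ν.IsMulRightInvariant]
    (tm : Measure ↥(cmBorelTriple L 2 v).M) [tm.IsMulLeftInvariant] [IsFiniteMeasureOnCompacts tm] [tm.IsOpenPosMeasure] [tm.IsInvInvariant]
    (Φ : (↥(unitaryGroupOfForm (conjLocal L (IsCMField.complexConj L) v) (cmLocalForm L 2 v)) ⧸ (cmBorelTriple L 2 v).M) × ↥(cmBorelTriple L 2 v).M → ↥(unitaryGroupOfForm (conjLocal L (IsCMField.complexConj L) v) (cmLocalForm L 2 v))) (hΦ : ∀ (x : ↥(unitaryGroupOfForm (conjLocal L (IsCMField.complexConj L) v) (cmLocalForm L 2 v))) (t : ↥(cmBorelTriple L 2 v).M), Φ (QuotientGroup.mk x, t) = x * t * x⁻¹)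
    (f : ↥(unitaryGroupOfForm (conjLocal L (IsCMField.complexConj L) v) (cmLocalForm L 2 v)) → ℝ≥0∞) (hf : Measurable f) :
    2 * ∫⁻ y in {x | ∃ g t : ↥(unitaryGroupOfForm (conjLocal L (IsCMField.complexConj L) v) (cmLocalForm L 2 v)), t ∈ (cmBorelTriple L 2 v).M ∧ IsRegularElt (t : GL (Fin 2) (LocalRing L v)) ∧ g * t * g⁻¹ = x}, f y ∂ν =
      ∫⁻ t in {t : ↥(cmBorelTriple L 2 v).M | IsRegularElt (((t : ↥(unitaryGroupOfForm (conjLocal L (IsCMField.complexConj L) v) (cmLocalForm L 2 v)))) : GL (Fin 2) (LocalRing L v))}, ((NNReal.sqrt ((∏ w' : PlacesOver L v, normAbs (w'.1.adicCompletion L) ((((t : ↥(unitaryGroupOfForm (conjLocal L (IsCMField.complexConj L) v) (cmLocalForm L 2 v))) : GL (Fin 2) (UnitaryGroup.LocalRing L v)).val.charpoly.discr) w')) * (∏ w' : PlacesOver L v, normAbs (w'.1.adicCompletion L) ((((t : ↥(unitaryGroupOfForm (conjLocal L (IsCMField.complexConj L) v) (cmLocalForm L 2 v))) : GL (Fin 2)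 (UnitaryGroup.LocalRing L v)).val.det) w'))⁻¹) : ℝ≥0) : ℝ≥0∞) *
        ∫⁻ q, f (Φ (q, t)) ∂(quotientMeasure (cmBorelTriple L 2 v).M tm (isClosed_cmBorelTriple_M_two L v) ν) ∂tm := by
  classical
  haveI : Nontrivial (LocalRing L v) := UnitaryGroup.nontrivial_localRing L v
  have hR : ∀ x : LocalRing L v, x ≠ 0 → IsUnit x := isUnit_of_ne_zero_of_nonsplit L v hns
  have hJ : cmLocalForm L 2 v = (StdForm.antidiagonal 2).over (LocalRing L v) := cmLocalForm_eq_over L 2 v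
  have hex := exists_mem_torusU_isRegularElt_two_cm L v hns
  have hT := isClosed_cmBorelTriple_M_two L v
  have hTc : ∀ a ∈ (cmBorelTriple L 2 v).M, ∀ b ∈ (cmBorelTriple L 2 v).M, a * b = b * a :=
    F0P3cStCharTSUpTrU2Norm.forall_mem_torusU_mul_comm (conjLocal L (IsCMField.complexConj L) v)
  have hW : (((cmBorelTriple L 2 v).M).subgroupOf (Subgroup.normalizer (((cmBorelTriple L 2 v).M : Subgroup ↥(unitaryGroupOfForm (conjLocal L (IsCMField.complexConj L) v) (cmLocalForm L 2 v))) : Set ↥(unitaryGroupOfForm (conjLocal L (IsCMField.complexConj L) v) (cmLocalForm L 2 v))))).index = 2 :=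
    F0P3cStCharTSUpTrU2Norm.index_torusU_subgroupOf_normalizer_two_eq_two (conjLocal L (IsCMField.complexConj L) v) hR hJ hex
  have hW0 := ne_of_eq_of_ne hW two_ne_zero
  have hRm : MeasurableSet {x : ↥(unitaryGroupOfForm (conjLocal L (IsCMField.complexConj L) v) (cmLocalForm L 2 v)) | IsRegularElt (x : GL (Fin 2) (LocalRing L v))} := (isOpen_setOf_isRegularElt₂ L v hns).measurableSet
  have hRc : ∀ g x : ↥(unitaryGroupOfForm (conjLocal L (IsCMField.complexConj L) v) (cmLocalForm L 2 v)), x ∈ {x : ↥(unitaryGroupOfForm (conjLocal L (IsCMField.complexConj L) v) (cmLocalForm L 2 v)) | IsRegularElt (x : GL (Fin 2) (LocalRing L v))} → g * x * g⁻¹ ∈ {x : ↥(unitaryGroupOfForm (conjLocal L (IsCMField.complexConj L) v) (cmLocalForm L 2 v)) | IsRegularElt (x : GL (Fin 2) (LocalRing L v))} := fun g x hx =>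
    (isRegularElt_coe_conj_iff (conjLocal L (IsCMField.complexConj L) v) (cmLocalForm L 2 v) g x).2 hx
  have hRT : ∀ t : ↥(cmBorelTriple L 2 v).M, (t : ↥(unitaryGroupOfForm (conjLocal L (IsCMField.complexConj L) v) (cmLocalForm L 2 v))) ∈ {x : ↥(unitaryGroupOfForm (conjLocal L (IsCMField.complexConj L) v) (cmLocalForm L 2 v)) | IsRegularElt (x : GL (Fin 2) (LocalRing L v))} → Subgroup.centralizer ({(t : ↥(unitaryGroupOfForm (conjLocal L (IsCMField.complexConj L) v) (cmLocalForm L 2 v)))} : Set ↥(unitaryGroupOfForm (conjLocal L (IsCMField.complexConj L) v) (cmLocalForm L 2 v))) = (cmBorelTriple L 2 v).M := fun t ht =>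
    centralizer_eq_torusU_of_isRegularElt (conjLocal L (IsCMField.complexConj L) v) (cmLocalForm L 2 v) t.2 ht
  have h := F0P3cStCharTSUpTrJacobian.lintegral_cartanSet_eq_of_tubeJacobian_local hRm hRc hT hTc hRT hW0 Φ hΦ ν tm
    (fun t : ↥(cmBorelTriple L 2 v).M => NNReal.sqrt ((∏ w' : PlacesOver L v, normAbs (w'.1.adicCompletion L) ((((t : ↥(unitaryGroupOfForm (conjLocal L (IsCMField.complexConj L) v) (cmLocalForm L 2 v))) : GL (Fin 2) (UnitaryGroup.LocalRing L v)).val.charpoly.discr) w')) * (∏ w' : PlacesOver L v, normAbs (w'.1.adicCompletion L) ((((t : ↥(unitaryGroupOfForm (conjLocal L (IsCMField.complexConj L) v) (cmLocalForm L 2 v))) : GL (Fin 2) (UnitaryGroup.LocalRing L v)).val.det) w'))⁻¹)) (measurable_sqrt_radicand₂ L v) (tubeJacobianLocal_cmTorus₂ L v hns Φ hΦ ν tm) f hf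
  rw [hW, Nat.cast_ofNat] at h
  exact h

set_option maxHeartbeats 1600000 in
-- as above
/-- **THE WEYL INTEGRATION FORMULA ON THE HYPERBOLIC SET OF `U(1,1)`, DENSITY FORM, BOCHNER VERSION** (same data): for every `g : G₂ → ℂ` that is `ν`-integrable on `Ω₂`, the integrand
`(t, q) ↦ g(Φ(q, t))` is integrable for `(√(N(disc)·N(det)⁻¹) · tm|_{T₂^{reg}}) ⊗ μ₀` and **`∫_{t ∈ T₂^{reg}} √(N(discr χ_t)·N(det t)⁻¹) • (∫_{G₂⧸T₂} g(Φ(q, t)) dμ₀) dtm = 2 • ∫_{Ω₂} g dν`**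
— ★ GENERIC `integral_cartanSet_eq_of_tubeJacobian_local` with the §2 inputs. [cite: Rogawski1990, §12.5 p. 182] [cite: HarishChandra1970, Lemma 42] [cite: DeitmarEchterhoff2014, Thm. 1.5.3] -/
theorem integral_hypSet₂_eq_of_haar (hns : ∀ w : PlacesOver L v, IsCMField.complexConj L • w.1 = w.1)
    [MeasurableSpace ↥(unitaryGroupOfForm (conjLocal L (IsCMField.complexConj L) v) (cmLocalForm L 2 v))] [BorelSpace ↥(unitaryGroupOfForm (conjLocal L (IsCMField.complexConj L) v) (cmLocalForm L 2 v))] [LocallyCompactSpace ↥(unitaryGroupOfForm (conjLocal L (IsCMField.complexConj L) v) (cmLocalForm L 2 v))] [SecondCountableTopology ↥(unitaryGroupOfForm (conjLocal L (IsCMField.complexConj L) v) (cmLocalForm L 2 v))] [T2Space ↥(unitaryGroupOfForm (conjLocal L (IsCMField.complexConj L) v) (cmLocalForm L 2 v))] [MeasurableSpace (↥(unitaryGroupOfForm (conjLocal L (IsCMField.complexConj L) v) (cmLocalForm L 2 v)) ⧸ (cmBorelTriple L 2 v).M)] [BorelSpace (↥(unitaryGroupOfForm (conjLocal L (IsCMField.complexConj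 L) v) (cmLocalForm L 2 v)) ⧸ (cmBorelTriple L 2 v).M)]
    (ν : Measure ↥(unitaryGroupOfForm (conjLocal L (IsCMField.complexConj L) v) (cmLocalForm L 2 v))) [ν.IsHaarMeasure] [ν.IsMulRightInvariant]
    (tm : Measure ↥(cmBorelTriple L 2 v).M) [tm.IsMulLeftInvariant] [IsFiniteMeasureOnCompacts tm] [tm.IsOpenPosMeasure] [tm.IsInvInvariant]
    (Φ : (↥(unitaryGroupOfForm (conjLocal L (IsCMField.complexConj L) v) (cmLocalForm L 2 v)) ⧸ (cmBorelTriple L 2 v).M) × ↥(cmBorelTriple L 2 v).M → ↥(unitaryGroupOfForm (conjLocal L (IsCMField.complexConj L) v) (cmLocalForm L 2 v))) (hΦ : ∀ (x : ↥(unitaryGroupOfForm (conjLocal L (IsCMField.complexConj L) v) (cmLocalForm L 2 v))) (t : ↥(cmBorelTriple L 2 v).M), Φ (QuotientGroup.mk x, t) = x * t * x⁻¹)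
    (g : ↥(unitaryGroupOfForm (conjLocal L (IsCMField.complexConj L) v) (cmLocalForm L 2 v)) → ℂ) (hg : IntegrableOn g {x | ∃ g t : ↥(unitaryGroupOfForm (conjLocal L (IsCMField.complexConj L) v) (cmLocalForm L 2 v)), t ∈ (cmBorelTriple L 2 v).M ∧ IsRegularElt (t : GL (Fin 2) (LocalRing L v)) ∧ g * t * g⁻¹ = x} ν) :
    Integrable (fun p : ↥(cmBorelTriple L 2 v).M × (↥(unitaryGroupOfForm (conjLocal L (IsCMField.complexConj L) v) (cmLocalForm L 2 v)) ⧸ (cmBorelTriple L 2 v).M) => g (Φ (p.2, p.1)))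
        (((tm.restrict {t : ↥(cmBorelTriple L 2 v).M | IsRegularElt (((t : ↥(unitaryGroupOfForm (conjLocal L (IsCMField.complexConj L) v) (cmLocalForm L 2 v)))) : GL (Fin 2) (LocalRing L v))}).withDensity fun t => ((NNReal.sqrt ((∏ w' : PlacesOver L v, normAbs (w'.1.adicCompletion L) ((((t : ↥(unitaryGroupOfForm (conjLocal L (IsCMField.complexConj L) v) (cmLocalForm L 2 v))) : GL (Fin 2) (UnitaryGroup.LocalRing L v)).val.charpoly.discr) w')) * (∏ w' : PlacesOver L v, normAbs (w'.1.adicCompletion L) ((((t : ↥(unitaryGroupOfForm (conjLocal L (IsCMField.complexConj L) v) (cmLocalForm L 2 v))) : GL (Fin 2) (UnitaryGroup.LocalRing L v)).val.det) w'))⁻¹) : ℝ≥0) : ℝ≥0∞)).prod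
          (quotientMeasure (cmBorelTriple L 2 v).M tm (isClosed_cmBorelTriple_M_two L v) ν)) ∧
      ∫ t in {t : ↥(cmBorelTriple L 2 v).M | IsRegularElt (((t : ↥(unitaryGroupOfForm (conjLocal L (IsCMField.complexConj L) v) (cmLocalForm L 2 v)))) : GL (Fin 2) (LocalRing L v))}, ((NNReal.sqrt ((∏ w' : PlacesOver L v, normAbs (w'.1.adicCompletion L) ((((t : ↥(unitaryGroupOfForm (conjLocal L (IsCMField.complexConj L) v) (cmLocalForm L 2 v))) : GL (Fin 2) (UnitaryGroup.LocalRing L v)).val.charpoly.discr) w')) * (∏ w' : PlacesOver L v, normAbs (w'.1.adicCompletion L) ((((t : ↥(unitaryGroupOfForm (conjLocal L (IsCMField.complexConj L) v) (cmLocalForm L 2 v))) : GL (Fin 2) (UnitaryGroup.LocalRing L v)).val.det) w'))⁻¹) : ℝ≥0) : ℝ) • ∫ q, g (Φ (q, t)) ∂(quotientMeasure (cmBorelTriple L 2 v).M tm (isClosed_cmBorelTriple_M_two L v) ν) ∂tm =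
        (2 : ℝ) • ∫ y in {x | ∃ g t : ↥(unitaryGroupOfForm (conjLocal L (IsCMField.complexConj L) v) (cmLocalForm L 2 v)), t ∈ (cmBorelTriple L 2 v).M ∧ IsRegularElt (t : GL (Fin 2) (LocalRing L v)) ∧ g * t * g⁻¹ = x}, g y ∂ν := by
  classical
  haveI : Nontrivial (LocalRing L v) := UnitaryGroup.nontrivial_localRing L v
  have hR : ∀ x : LocalRing L v, x ≠ 0 → IsUnit x := isUnit_of_ne_zero_of_nonsplit L v hns
  have hJ : cmLocalForm L 2 v = (StdForm.antidiagonal 2).over (LocalRing L v) := cmLocalForm_eq_over L 2 v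
  have hex := exists_mem_torusU_isRegularElt_two_cm L v hns
  have hT := isClosed_cmBorelTriple_M_two L v
  have hTc : ∀ a ∈ (cmBorelTriple L 2 v).M, ∀ b ∈ (cmBorelTriple L 2 v).M, a * b = b * a :=
    F0P3cStCharTSUpTrU2Norm.forall_mem_torusU_mul_comm (conjLocal L (IsCMField.complexConj L) v)
  have hW : (((cmBorelTriple L 2 v).M).subgroupOf (Subgroup.normalizer (((cmBorelTriple L 2 v).M : Subgroup ↥(unitaryGroupOfForm (conjLocal L (IsCMField.complexConj L) v) (cmLocalForm L 2 v))) : Set ↥(unitaryGroupOfForm (conjLocal L (IsCMField.complexConj L) v) (cmLocalForm L 2 v))))).index = 2 :=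
    F0P3cStCharTSUpTrU2Norm.index_torusU_subgroupOf_normalizer_two_eq_two (conjLocal L (IsCMField.complexConj L) v) hR hJ hex
  have hW0 := ne_of_eq_of_ne hW two_ne_zero
  have hRm : MeasurableSet {x : ↥(unitaryGroupOfForm (conjLocal L (IsCMField.complexConj L) v) (cmLocalForm L 2 v)) | IsRegularElt (x : GL (Fin 2) (LocalRing L v))} := (isOpen_setOf_isRegularElt₂ L v hns).measurableSet
  have hRc : ∀ g x : ↥(unitaryGroupOfForm (conjLocal L (IsCMField.complexConj L) v) (cmLocalForm L 2 v)), x ∈ {x : ↥(unitaryGroupOfForm (conjLocal L (IsCMField.complexConj L) v) (cmLocalForm L 2 v)) | IsRegularElt (x : GL (Fin 2) (LocalRing L v))} → g * x * g⁻¹ ∈ {x : ↥(unitaryGroupOfForm (conjLocal L (IsCMField.complexConj L) v) (cmLocalForm L 2 v)) | IsRegularElt (x : GL (Fin 2) (LocalRing L v))} := fun g x hx =>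
    (isRegularElt_coe_conj_iff (conjLocal L (IsCMField.complexConj L) v) (cmLocalForm L 2 v) g x).2 hx
  have hRT : ∀ t : ↥(cmBorelTriple L 2 v).M, (t : ↥(unitaryGroupOfForm (conjLocal L (IsCMField.complexConj L) v) (cmLocalForm L 2 v))) ∈ {x : ↥(unitaryGroupOfForm (conjLocal L (IsCMField.complexConj L) v) (cmLocalForm L 2 v)) | IsRegularElt (x : GL (Fin 2) (LocalRing L v))} → Subgroup.centralizer ({(t : ↥(unitaryGroupOfForm (conjLocal L (IsCMField.complexConj L) v) (cmLocalForm L 2 v)))} : Set ↥(unitaryGroupOfForm (conjLocal L (IsCMField.complexConj L) v) (cmLocalForm L 2 v))) = (cmBorelTriple L 2 v).M := fun t ht =>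
    centralizer_eq_torusU_of_isRegularElt (conjLocal L (IsCMField.complexConj L) v) (cmLocalForm L 2 v) t.2 ht
  have h := F0P3cStCharTSUpTrJacobian.integral_cartanSet_eq_of_tubeJacobian_local hRm hRc hT hTc hRT hW0 Φ hΦ ν tm
    (fun t : ↥(cmBorelTriple L 2 v).M => NNReal.sqrt ((∏ w' : PlacesOver L v, normAbs (w'.1.adicCompletion L) ((((t : ↥(unitaryGroupOfForm (conjLocal L (IsCMField.complexConj L) v) (cmLocalForm L 2 v))) : GL (Fin 2) (UnitaryGroup.LocalRing L v)).val.charpoly.discr) w')) * (∏ w' : PlacesOver L v, normAbs (w'.1.adicCompletion L) ((((t : ↥(unitaryGroupOfForm (conjLocal L (IsCMField.complexConj L) v) (cmLocalForm L 2 v))) : GL (Fin 2) (UnitaryGroup.LocalRing L v)).val.det) w'))⁻¹)) (measurable_sqrt_radicand₂ L v) (tubeJacobianLocal_cmTorus₂ L v hns Φ hΦ ν tm) g hg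
  rw [hW, Nat.cast_ofNat] at h
  exact h

/-! ## §3 The (ASM₂) heads: canonical orbital integrals, the parameter torus `(LocalRing L v)ˣ`, density `(2c₀)⁻¹ · dg₂²` -/

set_option maxHeartbeats 3200000 in
set_option synthInstance.maxHeartbeats 400000 in
-- instance-term unification at the CM carrier (`quotientMeasure` ∕ canonical family), as in the ★ `N = 3` original
/-- **THE WEYL INTEGRATION FORMULA ON `Ω₂` IN DENSITY FORM AGAINST CANONICAL ORBITAL INTEGRALS, WITH ITS INTEGRABILITY HALF** (`v` non-split; `ν` Haar on `G₂ = U(Φ₂)(L⁺_v)`,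
`mQv` canonical for the regular classes, `μM` ANY Haar measure on the parameter torus `(LocalRing L v)ˣ`, `ι₂ = torusChart₂ L v`, `c₀ = μM(ι₂⁻¹ T₂ᶜ)`).  For all `φ, α : G₂ → ℂ`,
`φ` measurable, `α` conjugation invariant on `Ω₂ = hyperbolicSet₂ L v`, `φ·α` `ν`-integrable on `Ω₂` and `φ = 0` off `Ω₂`:
**`∫ φ·α dν = ∫ m, classOrbitalIntegral mQv φ ⟦ι₂ m⟧ · ((2 c₀)⁻¹ · dgFormula₂(ι₂ m)²) · α(ι₂ m) dμM`**, AND the right-hand integrand is `μM`-integrable — the `N = 2` twin of ★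
`K2E3WeylHypDensityMeasurable` (both theorems), proof verbatim over §2 at THE normalised torus measure `tT = c₀⁻¹ • ι₂_*μM` (`tT(T₂ᶜ) = 1`), ★ KIT₂ `classOrbitalIntegral_mk_eq_integral_conjFamily₂`
(inner fibre integral `= α(t) · O^{can}_t(φ)`), `T₂^{reg}` of full measure ★ KIT₂ `ae_isRegularElt_cmTorus₂`, the pull-back along `ι₂`, and `√(N(disc)·N(det)⁻¹) = dg₂²` (§1).
[cite: Rogawski1990, §12.5 p. 182; §12.7 L. 12.7.2 (proof) p. 193] [cite: HarishChandra1970, Lemma 22; Lemma 42] [cite: DeitmarEchterhoff2014, Thm. 1.5.3] -/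
theorem density_wif_and_integrable₂ (hns : ∀ w : PlacesOver L v, IsCMField.complexConj L • w.1 = w.1)
    [MeasurableSpace ↥(unitaryGroupOfForm (conjLocal L (IsCMField.complexConj L) v) (cmLocalForm L 2 v))] [BorelSpace ↥(unitaryGroupOfForm (conjLocal L (IsCMField.complexConj L) v) (cmLocalForm L 2 v))] [LocallyCompactSpace ↥(unitaryGroupOfForm (conjLocal L (IsCMField.complexConj L) v) (cmLocalForm L 2 v))] [SecondCountableTopology ↥(unitaryGroupOfForm (conjLocal L (IsCMField.complexConj L) v) (cmLocalForm L 2 v))] [T2Space ↥(unitaryGroupOfForm (conjLocal L (IsCMField.complexConj L) v) (cmLocalForm L 2 v))]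
    [∀ γ : ↥(unitaryGroupOfForm (conjLocal L (IsCMField.complexConj L) v) (cmLocalForm L 2 v)), MeasurableSpace (↥(unitaryGroupOfForm (conjLocal L (IsCMField.complexConj L) v) (cmLocalForm L 2 v)) ⧸ Subgroup.centralizer ({γ} : Set ↥(unitaryGroupOfForm (conjLocal L (IsCMField.complexConj L) v) (cmLocalForm L 2 v))))] [∀ γ : ↥(unitaryGroupOfForm (conjLocal L (IsCMField.complexConj L) v) (cmLocalForm L 2 v)), BorelSpace (↥(unitaryGroupOfForm (conjLocal L (IsCMField.complexConj L) v) (cmLocalForm L 2 v)) ⧸ Subgroup.centralizer ({γ} : Set ↥(unitaryGroupOfForm (conjLocal L (IsCMField.complexConj L) v) (cmLocalForm L 2 v))))]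
    [MeasurableSpace (LocalRing L v)ˣ] [BorelSpace (LocalRing L v)ˣ]
    (ν : Measure ↥(unitaryGroupOfForm (conjLocal L (IsCMField.complexConj L) v) (cmLocalForm L 2 v))) [ν.IsHaarMeasure] [ν.IsMulRightInvariant]
    {mQv : OrbitalMeasureFamily ↥(unitaryGroupOfForm (conjLocal L (IsCMField.complexConj L) v) (cmLocalForm L 2 v))} (hcanQ : mQv.IsCanonical (fun γ => IsRegularElt (γ.val : GL (Fin 2) (LocalRing L v))) ν)
    (μM : Measure (LocalRing L v)ˣ) [μM.IsHaarMeasure]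
    (φ α : ↥(unitaryGroupOfForm (conjLocal L (IsCMField.complexConj L) v) (cmLocalForm L 2 v)) → ℂ) (hφm : Measurable φ)
    (hαinv : ∀ x : ↥(unitaryGroupOfForm (conjLocal L (IsCMField.complexConj L) v) (cmLocalForm L 2 v)), x ∈ (hyperbolicSet₂ L v : Set ↥(unitaryGroupOfForm (conjLocal L (IsCMField.complexConj L) v) (cmLocalForm L 2 v))) → ∀ h : ↥(unitaryGroupOfForm (conjLocal L (IsCMField.complexConj L) v) (cmLocalForm L 2 v)), α (h * x * h⁻¹) = α x)
    (hint : IntegrableOn (fun x => φ x * α x) (hyperbolicSet₂ L v : Set ↥(unitaryGroupOfForm (conjLocal L (IsCMField.complexConj L) v) (cmLocalForm L 2 v))) ν)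
    (hφ0 : ∀ x : ↥(unitaryGroupOfForm (conjLocal L (IsCMField.complexConj L) v) (cmLocalForm L 2 v)), x ∉ (hyperbolicSet₂ L v : Set ↥(unitaryGroupOfForm (conjLocal L (IsCMField.complexConj L) v) (cmLocalForm L 2 v))) → φ x = 0) :
    (∫ x, φ x * α x ∂ν =
      ∫ m, classOrbitalIntegral mQv φ (ConjClasses.mk (((torusChart₂ L v m : ↥(cmBorelTriple L 2 v).M) : ↥(unitaryGroupOfForm (conjLocal L (IsCMField.complexConj L) v) (cmLocalForm L 2 v))))) *
        ((((2 * (μM ((torusChart₂ L v) ⁻¹' compactCore ↥(cmBorelTriple L 2 v).M)).toReal)⁻¹ * dgFormula₂ L v (((torusChart₂ L v m : ↥(cmBorelTriple L 2 v).M) : ↥(unitaryGroupOfForm (conjLocal L (IsCMField.complexConj L) v) (cmLocalForm L 2 v)))) ^ 2 : ℝ)) : ℂ) *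
          α (((torusChart₂ L v m : ↥(cmBorelTriple L 2 v).M) : ↥(unitaryGroupOfForm (conjLocal L (IsCMField.complexConj L) v) (cmLocalForm L 2 v)))) ∂μM) ∧
    Integrable (fun m : (LocalRing L v)ˣ => classOrbitalIntegral mQv φ (ConjClasses.mk (((torusChart₂ L v m : ↥(cmBorelTriple L 2 v).M) : ↥(unitaryGroupOfForm (conjLocal L (IsCMField.complexConj L) v) (cmLocalForm L 2 v))))) *
        ((((2 * (μM ((torusChart₂ L v) ⁻¹' compactCore ↥(cmBorelTriple L 2 v).M)).toReal)⁻¹ * dgFormula₂ L v (((torusChart₂ L v m : ↥(cmBorelTriple L 2 v).M) : ↥(unitaryGroupOfForm (conjLocal L (IsCMField.complexConj L) v) (cmLocalForm L 2 v)))) ^ 2 : ℝ)) : ℂ) *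
          α (((torusChart₂ L v m : ↥(cmBorelTriple L 2 v).M) : ↥(unitaryGroupOfForm (conjLocal L (IsCMField.complexConj L) v) (cmLocalForm L 2 v))))) μM := by
  classical
  letI : MeasurableSpace (↥(unitaryGroupOfForm (conjLocal L (IsCMField.complexConj L) v) (cmLocalForm L 2 v)) ⧸ (cmBorelTriple L 2 v).M) := borel _
  haveI : BorelSpace (↥(unitaryGroupOfForm (conjLocal L (IsCMField.complexConj L) v) (cmLocalForm L 2 v)) ⧸ (cmBorelTriple L 2 v).M) := ⟨rfl⟩
  haveI : Nontrivial (LocalRing L v) := UnitaryGroup.nontrivial_localRing L v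
  have hR : ∀ x : LocalRing L v, x ≠ 0 → IsUnit x := isUnit_of_ne_zero_of_nonsplit L v hns
  have hT := isClosed_cmBorelTriple_M_two L v
  have hTc : ∀ a ∈ (cmBorelTriple L 2 v).M, ∀ b ∈ (cmBorelTriple L 2 v).M, a * b = b * a :=
    F0P3cStCharTSUpTrU2Norm.forall_mem_torusU_mul_comm (conjLocal L (IsCMField.complexConj L) v)
  haveI : LocallyCompactSpace ↥(cmBorelTriple L 2 v).M := hT.isClosedEmbedding_subtypeVal.locallyCompactSpace
  haveI : SecondCountableTopology ↥(cmBorelTriple L 2 v).M := TopologicalSpace.Subtype.secondCountableTopology _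
  -- §a the Haar measure `tm = ι₂_* μM` on `T₂`, the constant `c₀`, THE normalised measure `tT`
  set tm : Measure ↥(cmBorelTriple L 2 v).M := μM.map (torusChart₂ L v) with htm
  haveI : tm.IsHaarMeasure := isHaarMeasure_map_torusChart₂ L v μM
  haveI : SecondCountableTopology (LocalRing L v)ˣ := F0P3cStCharTSTorusRay.secondCountableTopology_units_localRing L v
  haveI : LocallyCompactSpace (LocalRing L v)ˣ := (torusChartEquiv₂ L v).toHomeomorph.isClosedEmbedding.locallyCompactSpace
  haveI : μM.Regular := Regular.of_sigmaCompactSpace_of_isLocallyFiniteMeasure μM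
  haveI : μM.IsInvInvariant := inferInstance
  haveI : tm.IsInvInvariant := by rw [htm]; exact isInvInvariant_map_torusChart₂ L v μM
  obtain ⟨hcoreC, hcoreO⟩ := isCompact_isOpen_compactCore_cmTorus₂ L v hns
  set c₀ : ℝ≥0∞ := tm (compactCore ↥(cmBorelTriple L 2 v).M) with hc₀
  have hc0 : c₀ ≠ 0 := (hcoreO.measure_pos tm ⟨1, one_mem_compactCore⟩).ne'
  have hctop : c₀ ≠ ∞ := hcoreC.measure_lt_top.ne
  have hmap : c₀ = μM ((torusChart₂ L v) ⁻¹' compactCore ↥(cmBorelTriple L 2 v).M) := by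
    rw [hc₀, htm]; exact map_torusChart₂_apply_compactCore L v hns μM
  set tT : Measure ↥(cmBorelTriple L 2 v).M := c₀⁻¹ • tm with htT
  haveI : tT.IsHaarMeasure := Measure.IsHaarMeasure.smul tm (ENNReal.inv_ne_zero.2 hctop) (ENNReal.inv_ne_top.2 hc0)
  haveI : tT.IsInvInvariant := ⟨by rw [Measure.inv_def, htT, Measure.map_smul, ← Measure.inv_def, Measure.inv_eq_self]⟩
  have htT1 : tT (compactCore ↥(cmBorelTriple L 2 v).M) = 1 := by
    rw [htT, Measure.smul_apply, smul_eq_mul, ENNReal.inv_mul_cancel hc0 hctop]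
  -- §b the conjugation family; §2 (Bochner form) at `tT` for `g := φ · α`; the weight as an `ℝ≥0`-valued `D = dg₂²`
  obtain ⟨Φ, hΦ⟩ := exists_conjFamily (cmBorelTriple L 2 v).M hTc
  have hΩ := hyperbolicSet₂_eq_hypSet L v
  rw [hΩ] at hint hφ0 hαinv
  obtain ⟨hI, heq⟩ := integral_hypSet₂_eq_of_haar L v hns ν tT Φ hΦ (fun x => φ x * α x) hint
  obtain ⟨D, hD⟩ : ∃ D : ↥(cmBorelTriple L 2 v).M → ℝ≥0, D = fun t : ↥(cmBorelTriple L 2 v).M => NNReal.sqrt ((∏ w' : PlacesOver L v, normAbs (w'.1.adicCompletion L) ((((t : ↥(unitaryGroupOfForm (conjLocal L (IsCMField.complexConj L) v) (cmLocalForm L 2 v))) : GL (Fin 2) (UnitaryGroup.LocalRing L v)).val.charpoly.discr) w')) * (∏ w' : PlacesOver L v, normAbs (w'.1.adicCompletion L) ((((t : ↥(unitaryGroupOfForm (conjLocal L (IsCMField.complexConj L) v) (cmLocalForm L 2 v))) : GL (Fin 2) (UnitaryGroup.LocalRing L v)).val.det) w'))⁻¹) := ⟨_, rfl⟩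
  have hDm : Measurable D := by rw [hD]; exact measurable_sqrt_radicand₂ L v
  have hDsq : ∀ t : ↥(cmBorelTriple L 2 v).M, (D t : ℝ) = dgFormula₂ L v (t : ↥(unitaryGroupOfForm (conjLocal L (IsCMField.complexConj L) v) (cmLocalForm L 2 v))) ^ 2 := fun t => by rw [hD, dgFormula₂_sq_eq_coe_sqrt]
  have hI' : Integrable (fun p : ↥(cmBorelTriple L 2 v).M × (↥(unitaryGroupOfForm (conjLocal L (IsCMField.complexConj L) v) (cmLocalForm L 2 v)) ⧸ (cmBorelTriple L 2 v).M) => φ (Φ (p.2, p.1)) * α (Φ (p.2, p.1)))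
      (((tT.restrict {t : ↥(cmBorelTriple L 2 v).M | IsRegularElt (((t : ↥(unitaryGroupOfForm (conjLocal L (IsCMField.complexConj L) v) (cmLocalForm L 2 v)))) : GL (Fin 2) (LocalRing L v))}).withDensity fun t => (D t : ℝ≥0∞)).prod (quotientMeasure (cmBorelTriple L 2 v).M tT (isClosed_cmBorelTriple_M_two L v) ν)) := by
    rw [hD]; exact hI
  have heq' : ∫ t in {t : ↥(cmBorelTriple L 2 v).M | IsRegularElt (((t : ↥(unitaryGroupOfForm (conjLocal L (IsCMField.complexConj L) v) (cmLocalForm L 2 v)))) : GL (Fin 2) (LocalRing L v))}, (D t : ℝ) • ∫ q, φ (Φ (q, t)) * α (Φ (q, t)) ∂(quotientMeasure (cmBorelTriple L 2 v).M tT (isClosed_cmBorelTriple_M_two L v) ν) ∂tT =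
      (2 : ℝ) • ∫ y in {x | ∃ g t : ↥(unitaryGroupOfForm (conjLocal L (IsCMField.complexConj L) v) (cmLocalForm L 2 v)), t ∈ (cmBorelTriple L 2 v).M ∧ IsRegularElt (t : GL (Fin 2) (LocalRing L v)) ∧ g * t * g⁻¹ = x}, φ y * α y ∂ν := by
    rw [hD]; exact heq
  -- §c the inner fibre integral at a regular `t` is `α(t) · O^{can}_t(φ)`
  have hinner : ∀ t : ↥(cmBorelTriple L 2 v).M, IsRegularElt (((t : ↥(unitaryGroupOfForm (conjLocal L (IsCMField.complexConj L) v) (cmLocalForm L 2 v)))) : GL (Fin 2) (LocalRing L v)) →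
      ∫ q, φ (Φ (q, t)) * α (Φ (q, t)) ∂(quotientMeasure (cmBorelTriple L 2 v).M tT (isClosed_cmBorelTriple_M_two L v) ν) =
        classOrbitalIntegral mQv φ (ConjClasses.mk (t : ↥(unitaryGroupOfForm (conjLocal L (IsCMField.complexConj L) v) (cmLocalForm L 2 v)))) * α t := by
    intro t ht
    have htΩ : (t : ↥(unitaryGroupOfForm (conjLocal L (IsCMField.complexConj L) v) (cmLocalForm L 2 v))) ∈ {x | ∃ g t : ↥(unitaryGroupOfForm (conjLocal L (IsCMField.complexConj L) v) (cmLocalForm L 2 v)), t ∈ (cmBorelTriple L 2 v).M ∧ IsRegularElt (t : GL (Fin 2) (LocalRing L v)) ∧ g * t * g⁻¹ = x} := mem_hypSet_of_mem_torusU (conjLocal L (IsCMField.complexConj L) v) (cmLocalForm L 2 v) t.2 ht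
    have hpt : ∀ q, φ (Φ (q, t)) * α (Φ (q, t)) = φ (Φ (q, t)) * α t := by
      intro q
      induction q using QuotientGroup.induction_on with
      | H x => rw [hΦ, hαinv _ htΩ x]
    rw [integral_congr_ae (Eventually.of_forall hpt), integral_mul_const,
      classOrbitalIntegral_mk_eq_integral_conjFamily₂ L v ν hcanQ tT htT1 Φ hΦ t ht φ hφm]
  have hSm : MeasurableSet {t : ↥(cmBorelTriple L 2 v).M | IsRegularElt (((t : ↥(unitaryGroupOfForm (conjLocal L (IsCMField.complexConj L) v) (cmLocalForm L 2 v)))) : GL (Fin 2) (LocalRing L v))} := (isOpen_setOf_isRegularElt_torusU (conjLocal L (IsCMField.complexConj L) v) (cmLocalForm L 2 v) hR).measurableSet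
  have hae : ∀ᵐ t : ↥(cmBorelTriple L 2 v).M ∂tT, t ∈ {t : ↥(cmBorelTriple L 2 v).M | IsRegularElt (((t : ↥(unitaryGroupOfForm (conjLocal L (IsCMField.complexConj L) v) (cmLocalForm L 2 v)))) : GL (Fin 2) (LocalRing L v))} := ae_isRegularElt_cmTorus₂ L v tT
  have hme : MeasurableEmbedding (torusChart₂ L v) := measurableEmbedding_torusChart₂ L v
  refine ⟨?_, ?_⟩
  · -- §d the identity: `∫ φα = ½ ∫_{T₂^reg} D • (α · O) dtT = ½ ∫_{T₂} … dtT = ½ c₀⁻¹ ∫ … ∘ ι₂ dμM`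
    have h1 : ∫ x, φ x * α x ∂ν = ∫ x in {x | ∃ g t : ↥(unitaryGroupOfForm (conjLocal L (IsCMField.complexConj L) v) (cmLocalForm L 2 v)), t ∈ (cmBorelTriple L 2 v).M ∧ IsRegularElt (t : GL (Fin 2) (LocalRing L v)) ∧ g * t * g⁻¹ = x}, φ x * α x ∂ν :=
      (setIntegral_eq_integral_of_forall_compl_eq_zero fun x hx => by rw [hφ0 x hx, zero_mul]).symm
    have h2 : ∫ t in {t : ↥(cmBorelTriple L 2 v).M | IsRegularElt (((t : ↥(unitaryGroupOfForm (conjLocal L (IsCMField.complexConj L) v) (cmLocalForm L 2 v)))) : GL (Fin 2) (LocalRing L v))}, (D t : ℝ) • ∫ q, φ (Φ (q, t)) * α (Φ (q, t)) ∂(quotientMeasure (cmBorelTriple L 2 v).M tT (isClosed_cmBorelTriple_M_two L v) ν) ∂tT =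
        ∫ t, (D t : ℝ) • (classOrbitalIntegral mQv φ (ConjClasses.mk (t : ↥(unitaryGroupOfForm (conjLocal L (IsCMField.complexConj L) v) (cmLocalForm L 2 v)))) * α t) ∂tT := by
      rw [setIntegral_congr_fun hSm fun t ht => by rw [hinner t ht], Measure.restrict_eq_self_of_ae_mem hae]
    have h3 : (2 : ℝ) • ∫ x, φ x * α x ∂ν = ∫ t, (D t : ℝ) • (classOrbitalIntegral mQv φ (ConjClasses.mk (t : ↥(unitaryGroupOfForm (conjLocal L (IsCMField.complexConj L) v) (cmLocalForm L 2 v)))) * α t) ∂tT := by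
      rw [h1, ← heq', h2]
    have h4 : ∫ t, (D t : ℝ) • (classOrbitalIntegral mQv φ (ConjClasses.mk (t : ↥(unitaryGroupOfForm (conjLocal L (IsCMField.complexConj L) v) (cmLocalForm L 2 v)))) * α t) ∂tT =
        (c₀⁻¹).toReal • ∫ m, (D (torusChart₂ L v m) : ℝ) •
          (classOrbitalIntegral mQv φ (ConjClasses.mk (((torusChart₂ L v m : ↥(cmBorelTriple L 2 v).M) : ↥(unitaryGroupOfForm (conjLocal L (IsCMField.complexConj L) v) (cmLocalForm L 2 v))))) * α (((torusChart₂ L v m : ↥(cmBorelTriple L 2 v).M) : ↥(unitaryGroupOfForm (conjLocal L (IsCMField.complexConj L) v) (cmLocalForm L 2 v))))) ∂μM := by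
      rw [htT, integral_smul_measure, htm, integral_comp_torusChart₂]
    rw [← hmap]
    calc ∫ x, φ x * α x ∂ν = (2 : ℝ)⁻¹ • ((2 : ℝ) • ∫ x, φ x * α x ∂ν) := by
          rw [smul_smul, inv_mul_cancel₀ (two_ne_zero' ℝ), one_smul]
      _ = (2 : ℝ)⁻¹ • ((c₀⁻¹).toReal • ∫ m, (D (torusChart₂ L v m) : ℝ) •
            (classOrbitalIntegral mQv φ (ConjClasses.mk (((torusChart₂ L v m : ↥(cmBorelTriple L 2 v).M) : ↥(unitaryGroupOfForm (conjLocal L (IsCMField.complexConj L) v) (cmLocalForm L 2 v))))) * α (((torusChart₂ L v m : ↥(cmBorelTriple L 2 v).M) : ↥(unitaryGroupOfForm (conjLocal L (IsCMField.complexConj L) v) (cmLocalForm L 2 v))))) ∂μM) := by rw [h3, h4]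
      _ = ∫ m, (2 : ℝ)⁻¹ • ((c₀⁻¹).toReal • ((D (torusChart₂ L v m) : ℝ) •
            (classOrbitalIntegral mQv φ (ConjClasses.mk (((torusChart₂ L v m : ↥(cmBorelTriple L 2 v).M) : ↥(unitaryGroupOfForm (conjLocal L (IsCMField.complexConj L) v) (cmLocalForm L 2 v))))) * α (((torusChart₂ L v m : ↥(cmBorelTriple L 2 v).M) : ↥(unitaryGroupOfForm (conjLocal L (IsCMField.complexConj L) v) (cmLocalForm L 2 v))))))) ∂μM := by
          rw [← integral_smul, ← integral_smul]
      _ = _ := integral_congr_ae (Eventually.of_forall fun m => by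
          simp only [Complex.real_smul, ENNReal.toReal_inv, hDsq]
          push_cast
          ring)
  · -- §e integrability: Fubini in `t`, the density as a scalar, `T₂^{reg}` of full `tT`-measure, `tT = c₀⁻¹ • ι₂_*μM`, pull back along `ι₂`
    haveI : SigmaFinite (quotientMeasure (cmBorelTriple L 2 v).M tT (isClosed_cmBorelTriple_M_two L v) ν) := by
      haveI : SecondCountableTopology (↥(unitaryGroupOfForm (conjLocal L (IsCMField.complexConj L) v) (cmLocalForm L 2 v)) ⧸ (cmBorelTriple L 2 v).M) := (QuotientGroup.isQuotientMap_mk _).secondCountableTopology QuotientGroup.isOpenMap_coe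
      haveI : LocallyCompactSpace (↥(unitaryGroupOfForm (conjLocal L (IsCMField.complexConj L) v) (cmLocalForm L 2 v)) ⧸ (cmBorelTriple L 2 v).M) := QuotientGroup.instLocallyCompactSpace _
      haveI : SigmaCompactSpace (↥(unitaryGroupOfForm (conjLocal L (IsCMField.complexConj L) v) (cmLocalForm L 2 v)) ⧸ (cmBorelTriple L 2 v).M) := sigmaCompactSpace_of_locallyCompact_secondCountable
      exact SigmaFinite.of_isFiniteMeasureOnCompacts _
    have h1 : Integrable (fun t : ↥(cmBorelTriple L 2 v).M => ∫ q, φ (Φ (q, t)) * α (Φ (q, t)) ∂(quotientMeasure (cmBorelTriple L 2 v).M tT (isClosed_cmBorelTriple_M_two L v) ν))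
        ((tT.restrict {t : ↥(cmBorelTriple L 2 v).M | IsRegularElt (((t : ↥(unitaryGroupOfForm (conjLocal L (IsCMField.complexConj L) v) (cmLocalForm L 2 v)))) : GL (Fin 2) (LocalRing L v))}).withDensity fun t => (D t : ℝ≥0∞)) :=
      hI'.integral_prod_left
    rw [integrable_withDensity_iff_integrable_coe_smul hDm] at h1
    have h2 : Integrable (fun t : ↥(cmBorelTriple L 2 v).M => (D t : ℝ) • (classOrbitalIntegral mQv φ (ConjClasses.mk (t : ↥(unitaryGroupOfForm (conjLocal L (IsCMField.complexConj L) v) (cmLocalForm L 2 v)))) * α t)) (tT.restrict {t : ↥(cmBorelTriple L 2 v).M | IsRegularElt (((t : ↥(unitaryGroupOfForm (conjLocal L (IsCMField.complexConj L) v) (cmLocalForm L 2 v)))) : GL (Fin 2) (LocalRing L v))}) := by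
      refine h1.congr ?_
      filter_upwards [ae_restrict_mem hSm] with t ht
      rw [hinner t ht]
    rw [Measure.restrict_eq_self_of_ae_mem hae, htT, integrable_smul_measure (ENNReal.inv_ne_zero.2 hctop) (ENNReal.inv_ne_top.2 hc0), htm,
      hme.integrable_map_iff] at h2
    have h3 : Integrable (fun m : (LocalRing L v)ˣ => (((2 * (μM ((torusChart₂ L v) ⁻¹' compactCore ↥(cmBorelTriple L 2 v).M)).toReal)⁻¹ : ℝ) : ℂ) *
        ((D (torusChart₂ L v m) : ℝ) • (classOrbitalIntegral mQv φ (ConjClasses.mk (((torusChart₂ L v m : ↥(cmBorelTriple L 2 v).M) : ↥(unitaryGroupOfForm (conjLocal L (IsCMField.complexConj L) v) (cmLocalForm L 2 v))))) *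
          α (((torusChart₂ L v m : ↥(cmBorelTriple L 2 v).M) : ↥(unitaryGroupOfForm (conjLocal L (IsCMField.complexConj L) v) (cmLocalForm L 2 v))))))) μM :=
      h2.const_mul _
    refine h3.congr (Eventually.of_forall fun m => ?_)
    simp only [Complex.real_smul, hDsq]
    push_cast
    ring

/-- **THE (ASM₂) HEAD `hWEYL`, IDENTITY HALF** — `∫ φ·α dν = ∫ m, classOrbitalIntegral mQv φ ⟦ι₂ m⟧ · ((2 c₀)⁻¹ · dgFormula₂(ι₂ m)²) · α(ι₂ m) dμM` (§3
`density_wif_and_integrable₂`, first component; the `N = 2` twin of ★ `integral_mul_eq_integral_classOrbitalIntegral_density_of_measurable`).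
[cite: Rogawski1990, §12.5 p. 182; §12.7 L. 12.7.2 (proof) p. 193] [cite: HarishChandra1970, Lemma 22; Lemma 42] -/
theorem integral_mul_eq_integral_classOrbitalIntegral_density₂ (hns : ∀ w : PlacesOver L v, IsCMField.complexConj L • w.1 = w.1)
    [MeasurableSpace ↥(unitaryGroupOfForm (conjLocal L (IsCMField.complexConj L) v) (cmLocalForm L 2 v))] [BorelSpace ↥(unitaryGroupOfForm (conjLocal L (IsCMField.complexConj L) v) (cmLocalForm L 2 v))] [LocallyCompactSpace ↥(unitaryGroupOfForm (conjLocal L (IsCMField.complexConj L) v) (cmLocalForm L 2 v))] [SecondCountableTopology ↥(unitaryGroupOfForm (conjLocal L (IsCMField.complexConj L) v) (cmLocalForm L 2 v))] [T2Space ↥(unitaryGroupOfForm (conjLocal L (IsCMField.complexConj L) v) (cmLocalForm L 2 v))]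
    [∀ γ : ↥(unitaryGroupOfForm (conjLocal L (IsCMField.complexConj L) v) (cmLocalForm L 2 v)), MeasurableSpace (↥(unitaryGroupOfForm (conjLocal L (IsCMField.complexConj L) v) (cmLocalForm L 2 v)) ⧸ Subgroup.centralizer ({γ} : Set ↥(unitaryGroupOfForm (conjLocal L (IsCMField.complexConj L) v) (cmLocalForm L 2 v))))] [∀ γ : ↥(unitaryGroupOfForm (conjLocal L (IsCMField.complexConj L) v) (cmLocalForm L 2 v)), BorelSpace (↥(unitaryGroupOfForm (conjLocal L (IsCMField.complexConj L) v) (cmLocalForm L 2 v)) ⧸ Subgroup.centralizer ({γ} : Set ↥(unitaryGroupOfForm (conjLocal L (IsCMField.complexConj L) v) (cmLocalForm L 2 v))))]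
    [MeasurableSpace (LocalRing L v)ˣ] [BorelSpace (LocalRing L v)ˣ]
    (ν : Measure ↥(unitaryGroupOfForm (conjLocal L (IsCMField.complexConj L) v) (cmLocalForm L 2 v))) [ν.IsHaarMeasure] [ν.IsMulRightInvariant]
    {mQv : OrbitalMeasureFamily ↥(unitaryGroupOfForm (conjLocal L (IsCMField.complexConj L) v) (cmLocalForm L 2 v))} (hcanQ : mQv.IsCanonical (fun γ => IsRegularElt (γ.val : GL (Fin 2) (LocalRing L v))) ν)
    (μM : Measure (LocalRing L v)ˣ) [μM.IsHaarMeasure]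
    (φ α : ↥(unitaryGroupOfForm (conjLocal L (IsCMField.complexConj L) v) (cmLocalForm L 2 v)) → ℂ) (hφm : Measurable φ)
    (hαinv : ∀ x : ↥(unitaryGroupOfForm (conjLocal L (IsCMField.complexConj L) v) (cmLocalForm L 2 v)), x ∈ (hyperbolicSet₂ L v : Set ↥(unitaryGroupOfForm (conjLocal L (IsCMField.complexConj L) v) (cmLocalForm L 2 v))) → ∀ h : ↥(unitaryGroupOfForm (conjLocal L (IsCMField.complexConj L) v) (cmLocalForm L 2 v)), α (h * x * h⁻¹) = α x)
    (hint : IntegrableOn (fun x => φ x * α x) (hyperbolicSet₂ L v : Set ↥(unitaryGroupOfForm (conjLocal L (IsCMField.complexConj L) v) (cmLocalForm L 2 v))) ν)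
    (hφ0 : ∀ x : ↥(unitaryGroupOfForm (conjLocal L (IsCMField.complexConj L) v) (cmLocalForm L 2 v)), x ∉ (hyperbolicSet₂ L v : Set ↥(unitaryGroupOfForm (conjLocal L (IsCMField.complexConj L) v) (cmLocalForm L 2 v))) → φ x = 0) :
    ∫ x, φ x * α x ∂ν =
      ∫ m, classOrbitalIntegral mQv φ (ConjClasses.mk (((torusChart₂ L v m : ↥(cmBorelTriple L 2 v).M) : ↥(unitaryGroupOfForm (conjLocal L (IsCMField.complexConj L) v) (cmLocalForm L 2 v))))) *
        ((((2 * (μM ((torusChart₂ L v) ⁻¹' compactCore ↥(cmBorelTriple L 2 v).M)).toReal)⁻¹ * dgFormula₂ L v (((torusChart₂ L v m : ↥(cmBorelTriple L 2 v).M) : ↥(unitaryGroupOfForm (conjLocal L (IsCMField.complexConj L) v) (cmLocalForm L 2 v)))) ^ 2 : ℝ)) : ℂ) *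
          α (((torusChart₂ L v m : ↥(cmBorelTriple L 2 v).M) : ↥(unitaryGroupOfForm (conjLocal L (IsCMField.complexConj L) v) (cmLocalForm L 2 v)))) ∂μM :=
  (density_wif_and_integrable₂ L v hns ν hcanQ μM φ α hφm hαinv hint hφ0).1

/-- **THE (ASM₂) HEAD `hWEYL`, INTEGRABILITY HALF** — the density-side integrand `m ↦ classOrbitalIntegral mQv φ ⟦ι₂ m⟧ · ((2 c₀)⁻¹ · dgFormula₂(ι₂ m)²) · α(ι₂ m)` is
`μM`-integrable (§3 `density_wif_and_integrable₂`, second component; the `N = 2` twin of ★ `integrable_classOrbitalIntegral_density_mul_of_measurable`).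
[cite: Rogawski1990, §12.5 p. 182; §12.7 L. 12.7.2 (proof) p. 193] [cite: HarishChandra1970, Lemma 22; Lemma 42] -/
theorem integrable_classOrbitalIntegral_density_mul₂ (hns : ∀ w : PlacesOver L v, IsCMField.complexConj L • w.1 = w.1)
    [MeasurableSpace ↥(unitaryGroupOfForm (conjLocal L (IsCMField.complexConj L) v) (cmLocalForm L 2 v))] [BorelSpace ↥(unitaryGroupOfForm (conjLocal L (IsCMField.complexConj L) v) (cmLocalForm L 2 v))] [LocallyCompactSpace ↥(unitaryGroupOfForm (conjLocal L (IsCMField.complexConj L) v) (cmLocalForm L 2 v))] [SecondCountableTopology ↥(unitaryGroupOfForm (conjLocal L (IsCMField.complexConj L) v) (cmLocalForm L 2 v))] [T2Space ↥(unitaryGroupOfForm (conjLocal L (IsCMField.complexConj L) v) (cmLocalForm L 2 v))]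
    [∀ γ : ↥(unitaryGroupOfForm (conjLocal L (IsCMField.complexConj L) v) (cmLocalForm L 2 v)), MeasurableSpace (↥(unitaryGroupOfForm (conjLocal L (IsCMField.complexConj L) v) (cmLocalForm L 2 v)) ⧸ Subgroup.centralizer ({γ} : Set ↥(unitaryGroupOfForm (conjLocal L (IsCMField.complexConj L) v) (cmLocalForm L 2 v))))] [∀ γ : ↥(unitaryGroupOfForm (conjLocal L (IsCMField.complexConj L) v) (cmLocalForm L 2 v)), BorelSpace (↥(unitaryGroupOfForm (conjLocal L (IsCMField.complexConj L) v) (cmLocalForm L 2 v)) ⧸ Subgroup.centralizer ({γ} : Set ↥(unitaryGroupOfForm (conjLocal L (IsCMField.complexConj L) v) (cmLocalForm L 2 v))))]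
    [MeasurableSpace (LocalRing L v)ˣ] [BorelSpace (LocalRing L v)ˣ]
    (ν : Measure ↥(unitaryGroupOfForm (conjLocal L (IsCMField.complexConj L) v) (cmLocalForm L 2 v))) [ν.IsHaarMeasure] [ν.IsMulRightInvariant]
    {mQv : OrbitalMeasureFamily ↥(unitaryGroupOfForm (conjLocal L (IsCMField.complexConj L) v) (cmLocalForm L 2 v))} (hcanQ : mQv.IsCanonical (fun γ => IsRegularElt (γ.val : GL (Fin 2) (LocalRing L v))) ν)
    (μM : Measure (LocalRing L v)ˣ) [μM.IsHaarMeasure]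
    (φ α : ↥(unitaryGroupOfForm (conjLocal L (IsCMField.complexConj L) v) (cmLocalForm L 2 v)) → ℂ) (hφm : Measurable φ)
    (hαinv : ∀ x : ↥(unitaryGroupOfForm (conjLocal L (IsCMField.complexConj L) v) (cmLocalForm L 2 v)), x ∈ (hyperbolicSet₂ L v : Set ↥(unitaryGroupOfForm (conjLocal L (IsCMField.complexConj L) v) (cmLocalForm L 2 v))) → ∀ h : ↥(unitaryGroupOfForm (conjLocal L (IsCMField.complexConj L) v) (cmLocalForm L 2 v)), α (h * x * h⁻¹) = α x)
    (hint : IntegrableOn (fun x => φ x * α x) (hyperbolicSet₂ L v : Set ↥(unitaryGroupOfForm (conjLocal L (IsCMField.complexConj L) v) (cmLocalForm L 2 v))) ν)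
    (hφ0 : ∀ x : ↥(unitaryGroupOfForm (conjLocal L (IsCMField.complexConj L) v) (cmLocalForm L 2 v)), x ∉ (hyperbolicSet₂ L v : Set ↥(unitaryGroupOfForm (conjLocal L (IsCMField.complexConj L) v) (cmLocalForm L 2 v))) → φ x = 0) :
    Integrable (fun m : (LocalRing L v)ˣ => classOrbitalIntegral mQv φ (ConjClasses.mk (((torusChart₂ L v m : ↥(cmBorelTriple L 2 v).M) : ↥(unitaryGroupOfForm (conjLocal L (IsCMField.complexConj L) v) (cmLocalForm L 2 v))))) *
        ((((2 * (μM ((torusChart₂ L v) ⁻¹' compactCore ↥(cmBorelTriple L 2 v).M)).toReal)⁻¹ * dgFormula₂ L v (((torusChart₂ L v m : ↥(cmBorelTriple L 2 v).M) : ↥(unitaryGroupOfForm (conjLocal L (IsCMField.complexConj L) v) (cmLocalForm L 2 v)))) ^ 2 : ℝ)) : ℂ) *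
          α (((torusChart₂ L v m : ↥(cmBorelTriple L 2 v).M) : ↥(unitaryGroupOfForm (conjLocal L (IsCMField.complexConj L) v) (cmLocalForm L 2 v))))) μM :=
  (density_wif_and_integrable₂ L v hns ν hcanQ μM φ α hφm hαinv hint hφ0).2

end Summit.HodgeConjecture.HodgeConjecture.Cruxes.H413.K2E3QuasiSplitTwoWeylDensity

end
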